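import Summits.CriticalPhenomena.Ising3DConformalLimit.Theorems.PerfectScreeningSubharmonicOffOriginBetheThreshold
import Literature.Probability.LatticeModels.IsingConsistency
import HarnessLib

/-!
# Bethe-threshold subharmonicity on finite graphs and on the discrete torus
# (crux `SubharmonicOffOrigin`, stmt-CriticalPhenomena-1341, route PerfectScreening; by-product)

Corollaries of `Bethe.finiteVolume_bethe` (x-deleted DLR expansion + first Griffiths inequality)
for the Ising model on a whole FINITE graph, where the Gibbs measure does not depend on the boundary
condition (`isingExpect_univ_fixed`): for `β ≥ 0`, sites `o ≠ x` and `(deg x − 1)·tanh β ≤ 1`,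
`deg x · ⟨σ_oσ_x⟩ ≤ Σ_{y∼x} ⟨σ_oσ_y⟩` (`finiteGraph_bethe`), in particular for the periodic Ising
model on the discrete torus `(ℤ/Lℤ)^d` (`torus_bethe`; `deg x = 2d` for `L ≥ 3`, threshold
`tanh β ≤ 1/(2d−1)`).  This is the rigorous high-temperature window of the "natural general form"
of the crux recorded on its card ("every d, every β ≥ 0, tori included") and of the strategist's
all-`t` torus statement (`Cruxes/SubharmonicOffOrigin/STRATEGY-CENSUS.md` §S3, idea
`loop-o1-source-degree`): below the Bethe threshold it holds on every torus at every site; the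
window `1/(2d−1) < tanh β` (containing `β_c(3)`, `tanh β_c = 0.2181 > 1/5`) is where the loop
structure must enter.  The threshold is sharp among graphs of maximal degree `n`: the star `K_{1,n}`
violates the inequality at its centre iff `tanh β > 1/(n−1)` (cdisprove `Disproof.lean` §(c)).

References: S. Friedli, Y. Velenik, *Statistical Mechanics of Lattice Systems* (CUP 2017), §3.1
Def. 3.2 (periodic boundary condition), Lemma 6.7, Thm. 3.49 [FriedliVelenik2017].  Helpers of
stmt-CriticalPhenomena-1341 (`--supports`); no definition, no named fact.
-/

noncomputable section

open Finset
open Literature.Probability.LatticeModels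

namespace Summit.CriticalPhenomena.Ising3DConformalLimit.Theorems.PerfectScreening.Bethe

/-- **Bethe-threshold inequality on a whole finite graph.** For the nearest-neighbour Ising model on
a finite graph `G` (free = periodic = any boundary condition on the whole vertex set), zero field,
`β ≥ 0`, sites `o ≠ x` and `(deg x − 1)·tanh β ≤ 1`:
`deg x · ⟨σ_oσ_x⟩_{G;β} ≤ Σ_{y∼x} ⟨σ_oσ_y⟩_{G;β}` (x-deleted DLR expansion + GKS I,
Friedli–Velenik 2017 Lemma 6.7, Thm. 3.49; `finiteVolume_bethe` with `Λ = univ` and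
`isingExpect_univ_fixed`). -/
theorem finiteGraph_bethe {V : Type*} [Fintype V] [DecidableEq V] (G : SimpleGraph V)
    [DecidableRel G.Adj] {β : ℝ} (hβ : 0 ≤ β) {x o : V} (hox : o ≠ x)
    (ht : ((G.degree x : ℝ) - 1) * Real.tanh β ≤ 1) :
    (G.degree x : ℝ) * isingExpect G Finset.univ β 0 .free (spinPair o x) ≤
      ∑ y ∈ G.neighborFinset x, isingExpect G Finset.univ β 0 .free (spinPair o y) := by
  have h := finiteVolume_bethe G hβ (Finset.mem_univ x) hox ht
  have hplus : (BoundaryCondition.plus : BoundaryCondition V) = .fixed 1 := rfl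
  simpa only [hplus, isingExpect_univ_fixed] using h

/-- **Bethe-threshold subharmonicity of the periodic (torus) Ising two-point function off the
source.** On the discrete torus `(ℤ/Lℤ)^d`, for `β ≥ 0`, sites `o ≠ x` and
`(deg x − 1)·tanh β ≤ 1` (`deg x = 2d` when `L ≥ 3`):
`deg x · ⟨σ_oσ_x⟩_{𝕋;β} ≤ Σ_{y∼x} ⟨σ_oσ_y⟩_{𝕋;β}` — the high-temperature window of the card's general
(all `d`, all tori) form of SubH (Friedli–Velenik 2017 Def. 3.2, Lemma 6.7, Thm. 3.49). -/
theorem torus_bethe : ∀ {d L : ℕ} [NeZero L] {β : ℝ}, 0 ≤ β → ∀ {x o : TorusSite d L}, o ≠ x → (((torusGraph d L).degree x : ℝ) - 1) * Real.tanh β ≤ 1 → ((torusGraph d L).degree x : ℝ) * isingTorusTwoPoint d L β 0 o x ≤ ∑ y ∈ (torusGraph d L).neighborFinset x, isingTorusTwoPoint d L β 0 o y := by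
  intro d L _ β hβ x o hox ht
  exact finiteGraph_bethe (torusGraph d L) hβ hox ht

end Summit.CriticalPhenomena.Ising3DConformalLimit.Theorems.PerfectScreening.Bethe

end
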